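import Summits.QuantumFields.YangMills.Theorems.ColdStartUniversalityLatticeLangevinHaarSpectralGapRidge
import Summits.QuantumFields.YangMills.Theorems.ColdStartUniversalityLatticeLangevinWilsonGeneratorPoincareOfDecay
import HarnessLib

/-!
# Route `ColdStartUniversality` (fixed-cut-off `L²` package): the EXPLICIT spectral gap `3/2` of the `β' = 0` dynamics, II —
# all continuous observables, sharpness, and the Poincaré inequality with constant `3/2` for product Haar measure

Helper file (seat `ym-line-csu-p1`, g19; `--supports stmt-QuantumFields-27363`), sequel of `…HaarSpectralGapRidge`
(`integral_sq_transition_sub_le_exp_beta_zero_ridge`: decay at rate `3/2` on ridge form).  Here: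

* `integral_sq_transition_sub_le_of_uniform_approx` — a decay inequality `∫ (κ_t G − μG)² ≤ r² Var(G)` passes to UNIFORM limits
  (Minkowski in `L²(μ_{β'})` + the `L²`-contraction `integral_sq_transition_le`; the uniform twin of g16's
  `integral_sq_transition_sub_le_exp_of_measurable`), every `β'`;
* ★★ `integral_sq_transition_sub_le_exp_beta_zero` — THE EXPLICIT `L²` SPECTRAL GAP AT `β' = 0`: for every `L`, every Markov kernel
  family realising the `β' = 0` SZZ transition laws, every continuous `G`, every lattice time `t`,
  `∫ (κ⁰_t G − μ₀G)² dμ₀ ≤ e^{−2·(3/2)·t} Var_{μ₀}(G)`, `μ₀ = wilsonMeasure 0 = Haar^{⊗E}` (ridge decay + `exists_ridge_uniform_near`);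
* ★ `integral_sq_transition_sub_eq_beta_zero_degree_one` — SHARPNESS: EQUALITY for the degree-one latitude function
  `V ↦ U₁(⟨ρ h, ρ V_{e₀}⟩/2)` of one link, whose variance is `1`: the gap is exactly `3/2` (g16's existential Doeblin constant of
  `wilson_spectralGap`, at `β' = 0`, made explicit and optimal);
* ★★ `haar_generatorPoincare` — the GENERATOR-FORM POINCARÉ INEQUALITY WITH CONSTANT `3/2` for product Haar measure on `SU(2)^E`:
  `(3/2) Var_{μ₀}(F) ≤ −∫ (F − μ₀F) 𝓛₀f dμ₀` for every `C³` cylinder `F = f∘coords` (`𝓛₀` = the SZZ coordinate generator at `β' = 0`),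
  by g18's converse `generatorPoincare_of_integral_sq_transition_sub_le_exp` applied to THE kernels `exists_transitionKernel L 0`.
  This is the input of the Holley–Stroock transfer to `β' ≠ 0` (`…WilsonHolleyStroock`).

THEOREMS ONLY, no definition, no sorry.  HONEST FRAMING: RECORD-rung R3 plumbing at FIXED cut-off (here at `β' = 0`, no Yang–Mills
content); nothing K-uniform is proved; no crux, rung or summit statement is proved; the Yang–Mills mass gap is NOT proved.
-/

set_option autoImplicit false

noncomputable section

namespace Summit.QuantumFields.YangMills.Theorems.ColdStartUniversality

open MeasureTheory ProbabilityTheory Finset Filter Set Topology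
open scoped BigOperators NNReal ENNReal
open Literature.Probability.Process Literature.MathematicalPhysics.QuantumFieldTheory
open Literature.MathematicalPhysics.QuantumLattice (fundamentalRep fundamentalLatticeRep continuous_fundamentalRep)
open Literature.Analysis.SpecialFunctions (gegenbauerSum gegenbauerSum_zero gegenbauerSum_one)

variable {L : ℕ} [NeZero L]

/-! ## From a uniformly dense class to all continuous observables -/

/-- **A decay inequality passes to uniform limits.**  Let `κ` realise the SZZ transition laws at `β'` and `r ≥ 0`.  If a continuous
`F` is, for every `ε > 0`, uniformly `ε`-close to a continuous `G` with `∫ (κ_t G − μG)² dμ_{β'} ≤ r² ∫ (G − μG)² dμ_{β'}`, then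
`F` satisfies the same inequality (Minkowski in `L²(μ_{β'})` and the `L²`-contraction `integral_sq_transition_le` on `F − G`;
the uniform twin of `integral_sq_transition_sub_le_exp_of_measurable`). [folklore] -/
theorem integral_sq_transition_sub_le_of_uniform_approx (L : ℕ) [NeZero L] (β' : ℝ)
    (κ : ℝ≥0 → Kernel (GaugeConfig 3 L (Matrix.specialUnitaryGroup (Fin 2) ℂ))
      (GaugeConfig 3 L (Matrix.specialUnitaryGroup (Fin 2) ℂ))) [∀ t, IsMarkovKernel (κ t)]
    (hreal : ∀ (t : ℝ≥0) (x : GaugeConfig 3 L (Matrix.specialUnitaryGroup (Fin 2) ℂ))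
        (Ω : Type) [MeasurableSpace Ω] (P : Measure Ω) [IsProbabilityMeasure P]
        (W : ℝ≥0 → Ω → (Edge 3 L × NoiseIdx 2 → ℝ)) (hW : IsFlatBrownian W P)
        (U : ℝ≥0 → Ω → GaugeConfig 3 L (Matrix.specialUnitaryGroup (Fin 2) ℂ)),
        (∀ ω, U 0 ω = x) →
        (latticeLangevinDynamics (fundamentalLatticeRep 2) β').IsSolution (fundamentalRep (Fin 2))
          hW.natFiltration P W U →
        κ t x = P.map (U t))
    {r : ℝ} (hr : 0 ≤ r) {t : ℝ≥0}
    {F : GaugeConfig 3 L (Matrix.specialUnitaryGroup (Fin 2) ℂ) → ℝ} (hF : Continuous F)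
    (happrox : ∀ ε : ℝ, 0 < ε → ∃ G : GaugeConfig 3 L (Matrix.specialUnitaryGroup (Fin 2) ℂ) → ℝ, Continuous G ∧
      (∀ x, |F x - G x| ≤ ε) ∧
      ∫ x, ((∫ y, G y ∂(κ t x)) - ∫ z, G z ∂(wilsonMeasure (d := 3) (L := L) (fundamentalRep (Fin 2)) β')) ^ 2
          ∂(wilsonMeasure (d := 3) (L := L) (fundamentalRep (Fin 2)) β') ≤
        r ^ 2 * ∫ x, (G x - ∫ z, G z ∂(wilsonMeasure (d := 3) (L := L) (fundamentalRep (Fin 2)) β')) ^ 2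
          ∂(wilsonMeasure (d := 3) (L := L) (fundamentalRep (Fin 2)) β')) :
    ∫ x, ((∫ y, F y ∂(κ t x)) - ∫ z, F z ∂(wilsonMeasure (d := 3) (L := L) (fundamentalRep (Fin 2)) β')) ^ 2
        ∂(wilsonMeasure (d := 3) (L := L) (fundamentalRep (Fin 2)) β') ≤
      r ^ 2 * ∫ x, (F x - ∫ z, F z ∂(wilsonMeasure (d := 3) (L := L) (fundamentalRep (Fin 2)) β')) ^ 2
        ∂(wilsonMeasure (d := 3) (L := L) (fundamentalRep (Fin 2)) β') := by
  classical
  haveI := secondCountableTopology_su2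
  haveI := borelSpace_config L
  set μ : Measure (GaugeConfig 3 L (Matrix.specialUnitaryGroup (Fin 2) ℂ)) :=
    wilsonMeasure (d := 3) (L := L) (fundamentalRep (Fin 2)) β' with hμ
  haveI : IsProbabilityMeasure μ :=
    isProbabilityMeasure_wilsonMeasure (d := 3) (L := L) (fundamentalRep (Fin 2)) (continuous_fundamentalRep (Fin 2)) β'
  obtain ⟨M, -, hM⟩ := exists_abs_le_of_continuous hF
  have hFm : Measurable F := hF.measurable
  -- kernel images of bounded measurable functions are bounded measurable
  have hκm : ∀ {H : GaugeConfig 3 L (Matrix.specialUnitaryGroup (Fin 2) ℂ) → ℝ}, Measurable H →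
      Measurable (fun x => ∫ y, H y ∂(κ t x)) := fun hH =>
    (hH.stronglyMeasurable.integral_kernel (κ := κ t)).measurable
  have hκb : ∀ {H : GaugeConfig 3 L (Matrix.specialUnitaryGroup (Fin 2) ℂ) → ℝ} {C : ℝ}, (∀ x, |H x| ≤ C) →
      ∀ x, |∫ y, H y ∂(κ t x)| ≤ C := fun hC x => abs_integral_le_of_abs_le_of_isProbabilityMeasure hC
  have hμb : ∀ {H : GaugeConfig 3 L (Matrix.specialUnitaryGroup (Fin 2) ℂ) → ℝ} {C : ℝ}, (∀ x, |H x| ≤ C) →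
      |∫ z, H z ∂μ| ≤ C := fun hC => abs_integral_le_of_abs_le_of_isProbabilityMeasure hC
  -- `W H ≤ V H ≤ ∫ H²` on bounded measurable `H`
  have hWV : ∀ {H : GaugeConfig 3 L (Matrix.specialUnitaryGroup (Fin 2) ℂ) → ℝ}, Measurable H → ∀ {C : ℝ}, (∀ x, |H x| ≤ C) →
      ∫ x, ((∫ y, H y ∂(κ t x)) - ∫ z, H z ∂μ) ^ 2 ∂μ ≤ ∫ x, (H x - ∫ z, H z ∂μ) ^ 2 ∂μ := by
    intro H hH C hC
    set mH : ℝ := ∫ z, H z ∂μ with hmH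
    have hHc : Measurable fun x => H x - mH := hH.sub measurable_const
    have hHcb : ∀ x, |H x - mH| ≤ C + C := fun x =>
      (abs_sub _ _).trans (add_le_add (hC x) (hμb hC))
    have e : ∀ x, (∫ y, H y ∂(κ t x)) - mH = ∫ y, (H y - mH) ∂(κ t x) := by
      intro x
      rw [integral_sub (integrable_of_abs_le _ hH hC) (integrable_const mH)]
      simp
    simp_rw [e]
    exact integral_sq_transition_le L β' κ hreal t hHc ⟨C + C, hHcb⟩
  have hV2 : ∀ {H : GaugeConfig 3 L (Matrix.specialUnitaryGroup (Fin 2) ℂ) → ℝ}, Measurable H → ∀ {C : ℝ}, (∀ x, |H x| ≤ C) →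
      ∫ x, (H x - ∫ z, H z ∂μ) ^ 2 ∂μ ≤ ∫ x, (H x) ^ 2 ∂μ := by
    intro H hH C hC
    have hLp : MemLp H 2 μ :=
      MemLp.of_bound hH.aestronglyMeasurable C (ae_of_all _ fun x => by rw [Real.norm_eq_abs]; exact hC x)
    have hvar : variance H μ = ∫ x, (H x - ∫ z, H z ∂μ) ^ 2 ∂μ := variance_eq_integral hH.aemeasurable
    rw [← hvar, variance_eq_sub hLp]
    have h2 : μ[H ^ 2] = ∫ x, (H x) ^ 2 ∂μ := rfl
    rw [h2]
    linarith [sq_nonneg (μ[H])]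
  -- `√W F ≤ r √V F + ε` for every `ε > 0`
  set V : ℝ := ∫ x, (F x - ∫ z, F z ∂μ) ^ 2 ∂μ with hVdef
  set Wt : ℝ := ∫ x, ((∫ y, F y ∂(κ t x)) - ∫ z, F z ∂μ) ^ 2 ∂μ with hWdef
  have hV0 : 0 ≤ V := integral_nonneg fun x => sq_nonneg _
  have hW0 : 0 ≤ Wt := integral_nonneg fun x => sq_nonneg _
  have hkey : ∀ ε : ℝ, 0 < ε → Real.sqrt Wt ≤ r * Real.sqrt V + ε := by
    intro ε hε
    set δ : ℝ := ε / (r + 1) with hδ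
    have hδpos : 0 < δ := div_pos hε (by linarith)
    obtain ⟨G, hGc, hGF, hGdec⟩ := happrox δ hδpos
    obtain ⟨MG, -, hMG⟩ := exists_abs_le_of_continuous hGc
    -- the error `H = F − G`, uniformly `≤ δ`
    have hHm : Measurable fun x => F x - G x := hFm.sub hGc.measurable
    have hHb : ∀ x, |F x - G x| ≤ δ := hGF
    have hH2 : ∫ x, (F x - G x) ^ 2 ∂μ ≤ δ ^ 2 := by
      have hle : ∀ x, (F x - G x) ^ 2 ≤ δ ^ 2 := fun x => by
        rw [← sq_abs]; exact pow_le_pow_left₀ (abs_nonneg _) (hHb x) 2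
      calc ∫ x, (F x - G x) ^ 2 ∂μ ≤ ∫ _x, δ ^ 2 ∂μ :=
            integral_mono (integrable_of_abs_le μ (hHm.pow_const 2) (C := δ ^ 2) fun x => by
              rw [abs_pow, sq_abs, ← sq_abs]; exact pow_le_pow_left₀ (abs_nonneg _) (hHb x) 2) (integrable_const _) hle
        _ = δ ^ 2 := by rw [integral_const, probReal_univ, one_smul]
    have hsqH : Real.sqrt (∫ x, ((F x - G x) - ∫ z, (F z - G z) ∂μ) ^ 2 ∂μ) ≤ δ := by
      refine (Real.sqrt_le_sqrt ((hV2 hHm hHb).trans hH2)).trans ?_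
      rw [Real.sqrt_sq hδpos.le]
    have hsqWH : Real.sqrt (∫ x, ((∫ y, (F y - G y) ∂(κ t x)) - ∫ z, (F z - G z) ∂μ) ^ 2 ∂μ) ≤ δ :=
      (Real.sqrt_le_sqrt (hWV hHm hHb)).trans hsqH
    -- `√W G ≤ r √V G` (the hypothesis on the approximant)
    have hsqWG : Real.sqrt (∫ x, ((∫ y, G y ∂(κ t x)) - ∫ z, G z ∂μ) ^ 2 ∂μ) ≤
        r * Real.sqrt (∫ x, (G x - ∫ z, G z ∂μ) ^ 2 ∂μ) := by
      calc Real.sqrt (∫ x, ((∫ y, G y ∂(κ t x)) - ∫ z, G z ∂μ) ^ 2 ∂μ)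
          ≤ Real.sqrt (r ^ 2 * ∫ x, (G x - ∫ z, G z ∂μ) ^ 2 ∂μ) := Real.sqrt_le_sqrt hGdec
        _ = r * Real.sqrt (∫ x, (G x - ∫ z, G z ∂μ) ^ 2 ∂μ) := by
            rw [Real.sqrt_mul (sq_nonneg r), Real.sqrt_sq hr]
    -- Minkowski twice
    have hVG : Real.sqrt (∫ x, (G x - ∫ z, G z ∂μ) ^ 2 ∂μ) ≤ Real.sqrt V + δ := by
      have e : ∀ x, G x - ∫ z, G z ∂μ = (F x - ∫ z, F z ∂μ) + (-((F x - G x) - ∫ z, (F z - G z) ∂μ)) := by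
        intro x
        rw [integral_sub (integrable_of_abs_le μ hFm hM) (integrable_of_abs_le μ hGc.measurable hMG)]
        ring
      simp_rw [e]
      have hbm : Measurable fun x => -((F x - G x) - ∫ z, (F z - G z) ∂μ) := (hHm.sub measurable_const).neg
      refine (sqrt_integral_add_sq_le μ (hFm.sub measurable_const) hbm
        (Ca := M + M) (Cb := δ + δ) (fun x => (abs_sub _ _).trans (add_le_add (hM x) (hμb hM)))
        (fun x => by
          show |-((F x - G x) - ∫ z, (F z - G z) ∂μ)| ≤ δ + δ
          rw [abs_neg]; exact (abs_sub _ _).trans (add_le_add (hHb x) (hμb hHb)))).trans ?_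
      have e2 : ∀ x, (-((F x - G x) - ∫ z, (F z - G z) ∂μ)) ^ 2 = ((F x - G x) - ∫ z, (F z - G z) ∂μ) ^ 2 :=
        fun x => neg_sq _
      simp_rw [e2]
      exact add_le_add le_rfl hsqH
    have hWF : Real.sqrt Wt ≤ Real.sqrt (∫ x, ((∫ y, G y ∂(κ t x)) - ∫ z, G z ∂μ) ^ 2 ∂μ) +
        Real.sqrt (∫ x, ((∫ y, (F y - G y) ∂(κ t x)) - ∫ z, (F z - G z) ∂μ) ^ 2 ∂μ) := by
      have e : ∀ x, (∫ y, F y ∂(κ t x)) - ∫ z, F z ∂μ =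
          ((∫ y, G y ∂(κ t x)) - ∫ z, G z ∂μ) + ((∫ y, (F y - G y) ∂(κ t x)) - ∫ z, (F z - G z) ∂μ) := by
        intro x
        rw [integral_sub (integrable_of_abs_le _ hFm hM) (integrable_of_abs_le _ hGc.measurable hMG),
          integral_sub (integrable_of_abs_le μ hFm hM) (integrable_of_abs_le μ hGc.measurable hMG)]
        ring
      rw [hWdef]
      simp_rw [e]
      exact sqrt_integral_add_sq_le μ ((hκm hGc.measurable).sub measurable_const) ((hκm hHm).sub measurable_const)
        (Ca := MG + MG) (Cb := δ + δ)
        (fun x => (abs_sub _ _).trans (add_le_add (hκb hMG x) (hμb hMG)))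
        (fun x => (abs_sub _ _).trans (add_le_add (hκb hHb x) (hμb hHb)))
    have hfin : r * (Real.sqrt V + δ) + δ = r * Real.sqrt V + ε := by
      rw [hδ]; field_simp; ring
    calc Real.sqrt Wt ≤ r * (Real.sqrt V + δ) + δ := by
          nlinarith [hWF, hsqWG, hsqWH, hVG, hr]
      _ = r * Real.sqrt V + ε := hfin
  have hsq : Real.sqrt Wt ≤ r * Real.sqrt V := le_of_forall_pos_le_add hkey
  have h1 : Wt = Real.sqrt Wt ^ 2 := (Real.sq_sqrt hW0).symm
  rw [h1, show r ^ 2 * V = (r * Real.sqrt V) ^ 2 by rw [mul_pow, Real.sq_sqrt hV0]]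
  exact pow_le_pow_left₀ (Real.sqrt_nonneg _) hsq 2

/-! ## ★★ The explicit spectral gap `3/2` at `β' = 0` -/

/-- ★★ **THE EXPLICIT `L²` SPECTRAL GAP OF THE `β' = 0` DYNAMICS (Brownian motion on `SU(2)^E`) IS `3/2`.**  For every `L`, every
Markov kernel family `κ⁰` realising the `β' = 0` SZZ transition laws, every continuous `G` and every lattice time `t`:
`∫ (κ⁰_t G − μ₀G)² dμ₀ ≤ e^{−2·(3/2)·t} ∫ (G − μ₀G)² dμ₀`, `μ₀ = wilsonMeasure 0 = Haar^{⊗E}` — g16's `wilson_spectralGap` at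
`β' = 0` with the Doeblin constant replaced by the true gap (ridge decay + uniform density of ridge form + the uniform-limit bridge).
[folklore] -/
theorem integral_sq_transition_sub_le_exp_beta_zero (L : ℕ) [NeZero L]
    (κ₀ : ℝ≥0 → Kernel (GaugeConfig 3 L (Matrix.specialUnitaryGroup (Fin 2) ℂ))
      (GaugeConfig 3 L (Matrix.specialUnitaryGroup (Fin 2) ℂ))) [∀ t, IsMarkovKernel (κ₀ t)]
    (hreal₀ : ∀ (t : ℝ≥0) (x : GaugeConfig 3 L (Matrix.specialUnitaryGroup (Fin 2) ℂ))
        (Ω : Type) [MeasurableSpace Ω] (P : Measure Ω) [IsProbabilityMeasure P]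
        (W : ℝ≥0 → Ω → (Edge 3 L × NoiseIdx 2 → ℝ)) (hW : IsFlatBrownian W P)
        (U : ℝ≥0 → Ω → GaugeConfig 3 L (Matrix.specialUnitaryGroup (Fin 2) ℂ)),
        (∀ ω, U 0 ω = x) →
        (latticeLangevinDynamics (fundamentalLatticeRep 2) 0).IsSolution (fundamentalRep (Fin 2))
          hW.natFiltration P W U →
        κ₀ t x = P.map (U t))
    {G : GaugeConfig 3 L (Matrix.specialUnitaryGroup (Fin 2) ℂ) → ℝ} (hG : Continuous G) (t : ℝ≥0) :
    ∫ x, ((∫ y, G y ∂(κ₀ t x)) - ∫ z, G z ∂(wilsonMeasure (d := 3) (L := L) (fundamentalRep (Fin 2)) 0)) ^ 2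
        ∂(wilsonMeasure (d := 3) (L := L) (fundamentalRep (Fin 2)) 0) ≤
      Real.exp (-2 * (3 / 2) * t) *
        ∫ x, (G x - ∫ z, G z ∂(wilsonMeasure (d := 3) (L := L) (fundamentalRep (Fin 2)) 0)) ^ 2
          ∂(wilsonMeasure (d := 3) (L := L) (fundamentalRep (Fin 2)) 0) := by
  classical
  set r : ℝ := Real.exp (-(3 / 2) * t) with hr
  have hr0 : 0 ≤ r := (Real.exp_pos _).le
  have hr2 : Real.exp (-2 * (3 / 2) * t) = r ^ 2 := by
    rw [hr, ← Real.exp_nat_mul]; congr 1; push_cast; ring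
  rw [hr2]
  refine integral_sq_transition_sub_le_of_uniform_approx L 0 κ₀ hreal₀ hr0 hG fun ε hε => ?_
  obtain ⟨ι, _, c, g, m, hF⟩ := exists_ridge_uniform_near (L := L) hG hε
  refine ⟨fun V => ∑ l, c l * ∏ e, gegenbauerSum 1 (m l e)
      (hsForm 2 (fundamentalRep (Fin 2) (g l e)) (fundamentalRep (Fin 2) (V e)) / 2),
    continuous_finsetSum _ fun l _ => continuous_const.mul (continuous_prod_gegenbauer_latitude (L := L) (g l) (m l)),
    fun x => ?_, ?_⟩
  · rw [abs_sub_comm]; exact (hF x).le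
  · rw [← hr2]
    exact integral_sq_transition_sub_le_exp_beta_zero_ridge κ₀ hreal₀ c g m t

/-! ## ★ Sharpness: the rate `3/2` is attained -/

/-- ★ **SHARPNESS of the gap `3/2`.**  For the degree-one latitude function `G(V) = U₁(⟨ρ h, ρ V_{e₀}⟩/2)` of a single link (an
eigenfunction: `κ⁰_t G = e^{−(3/2)t} G`, `μ₀G = 0`) the decay inequality is an EQUALITY, and `Var_{μ₀}(G) = ∫ G² dμ₀ = 1 ≠ 0`; hence no
rate `λ > 3/2` is possible in `integral_sq_transition_sub_le_exp_beta_zero`. [folklore] -/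
theorem integral_sq_transition_sub_eq_beta_zero_degree_one (L : ℕ) [NeZero L]
    (κ₀ : ℝ≥0 → Kernel (GaugeConfig 3 L (Matrix.specialUnitaryGroup (Fin 2) ℂ))
      (GaugeConfig 3 L (Matrix.specialUnitaryGroup (Fin 2) ℂ))) [∀ t, IsMarkovKernel (κ₀ t)]
    (hreal₀ : ∀ (t : ℝ≥0) (x : GaugeConfig 3 L (Matrix.specialUnitaryGroup (Fin 2) ℂ))
        (Ω : Type) [MeasurableSpace Ω] (P : Measure Ω) [IsProbabilityMeasure P]
        (W : ℝ≥0 → Ω → (Edge 3 L × NoiseIdx 2 → ℝ)) (hW : IsFlatBrownian W P)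
        (U : ℝ≥0 → Ω → GaugeConfig 3 L (Matrix.specialUnitaryGroup (Fin 2) ℂ)),
        (∀ ω, U 0 ω = x) →
        (latticeLangevinDynamics (fundamentalLatticeRep 2) 0).IsSolution (fundamentalRep (Fin 2))
          hW.natFiltration P W U →
        κ₀ t x = P.map (U t))
    (h : Matrix.specialUnitaryGroup (Fin 2) ℂ) (e₀ : Edge 3 L) (t : ℝ≥0) :
    ∫ x, ((∫ y, gegenbauerSum 1 1 (hsForm 2 (fundamentalRep (Fin 2) h) (fundamentalRep (Fin 2) (y e₀)) / 2) ∂(κ₀ t x)) -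
        ∫ z, gegenbauerSum 1 1 (hsForm 2 (fundamentalRep (Fin 2) h) (fundamentalRep (Fin 2) (z e₀)) / 2)
          ∂(wilsonMeasure (d := 3) (L := L) (fundamentalRep (Fin 2)) 0)) ^ 2
        ∂(wilsonMeasure (d := 3) (L := L) (fundamentalRep (Fin 2)) 0) =
      Real.exp (-2 * (3 / 2) * t) *
        ∫ x, (gegenbauerSum 1 1 (hsForm 2 (fundamentalRep (Fin 2) h) (fundamentalRep (Fin 2) (x e₀)) / 2) -
          ∫ z, gegenbauerSum 1 1 (hsForm 2 (fundamentalRep (Fin 2) h) (fundamentalRep (Fin 2) (z e₀)) / 2)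
            ∂(wilsonMeasure (d := 3) (L := L) (fundamentalRep (Fin 2)) 0)) ^ 2
          ∂(wilsonMeasure (d := 3) (L := L) (fundamentalRep (Fin 2)) 0) ∧
    ∫ x, (gegenbauerSum 1 1 (hsForm 2 (fundamentalRep (Fin 2) h) (fundamentalRep (Fin 2) (x e₀)) / 2) -
        ∫ z, gegenbauerSum 1 1 (hsForm 2 (fundamentalRep (Fin 2) h) (fundamentalRep (Fin 2) (z e₀)) / 2)
          ∂(wilsonMeasure (d := 3) (L := L) (fundamentalRep (Fin 2)) 0)) ^ 2
        ∂(wilsonMeasure (d := 3) (L := L) (fundamentalRep (Fin 2)) 0) = 1 := by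
  classical
  haveI := secondCountableTopology_su2
  haveI := borelSpace_config L
  haveI : IsProbabilityMeasure (haarProbability (Matrix.specialUnitaryGroup (Fin 2) ℂ)) := inferInstance
  rw [wilsonMeasure_zero_eq_pi]
  set π : Measure (GaugeConfig 3 L (Matrix.specialUnitaryGroup (Fin 2) ℂ)) :=
    Measure.pi fun _ : Edge 3 L => haarProbability (Matrix.specialUnitaryGroup (Fin 2) ℂ) with hπ
  -- the ridge datum: one term, degree vector `m = δ_{e₀}`
  set m : Edge 3 L → ℕ := Pi.single e₀ 1 with hm
  have hm0 : m ≠ 0 := by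
    intro h0; have := congr_fun h0 e₀; simp [hm] at this
  have hprod : ∀ y : GaugeConfig 3 L (Matrix.specialUnitaryGroup (Fin 2) ℂ),
      ∏ e, gegenbauerSum 1 (m e) (hsForm 2 (fundamentalRep (Fin 2) h) (fundamentalRep (Fin 2) (y e)) / 2) =
        gegenbauerSum 1 1 (hsForm 2 (fundamentalRep (Fin 2) h) (fundamentalRep (Fin 2) (y e₀)) / 2) := by
    intro y
    rw [Finset.prod_eq_single e₀ (fun e _ hne => by rw [hm, Pi.single_eq_of_ne hne, gegenbauerSum_zero])
      (fun h' => absurd (Finset.mem_univ e₀) h')]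
    rw [hm, Pi.single_eq_same]
  have hev : ∑ e, (m e : ℝ) * ((m e : ℝ) + 2) / 2 = 3 / 2 := by
    rw [Finset.sum_eq_single e₀ (fun e _ hne => by rw [hm, Pi.single_eq_of_ne hne]; simp)
      (fun h' => absurd (Finset.mem_univ e₀) h')]
    rw [hm, Pi.single_eq_same]; norm_num
  -- kernel action: `κ⁰_t G = e^{−(3/2)t} G`
  have hκ : ∀ x, ∫ y, gegenbauerSum 1 1 (hsForm 2 (fundamentalRep (Fin 2) h) (fundamentalRep (Fin 2) (y e₀)) / 2) ∂(κ₀ t x) =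
      Real.exp (-(3 / 2) * t) * gegenbauerSum 1 1 (hsForm 2 (fundamentalRep (Fin 2) h) (fundamentalRep (Fin 2) (x e₀)) / 2) := by
    intro x
    have hk := integral_ridge_transitionKernel_beta_zero κ₀ hreal₀ (ι := Unit) (fun _ => (1 : ℝ)) (fun _ _ => h) (fun _ => m) t x
    simp only [Finset.univ_unique, Finset.sum_singleton, one_mul, hprod, hev] at hk
    rw [hk]
  -- mean zero and second moment one
  have hmean : ∫ z, gegenbauerSum 1 1 (hsForm 2 (fundamentalRep (Fin 2) h) (fundamentalRep (Fin 2) (z e₀)) / 2) ∂π = 0 := by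
    have h1 := integral_prod_gegenbauer_latitude_pi_haar (L := L) (fun _ => h) m
    simp only [hprod, if_neg hm0] at h1
    exact h1
  have hsq : ∫ z, (gegenbauerSum 1 1 (hsForm 2 (fundamentalRep (Fin 2) h) (fundamentalRep (Fin 2) (z e₀)) / 2)) ^ 2 ∂π = 1 := by
    have h1 := integral_prod_gegenbauer_mul_prod_gegenbauer_pi_haar (L := L) (fun _ => h) (fun _ => h) m m
    simp only [hprod, if_true] at h1
    rw [Finset.prod_eq_single e₀ (fun e _ hne => by rw [hm, Pi.single_eq_of_ne hne, gegenbauerSum_zero]; simp)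
      (fun h' => absurd (Finset.mem_univ e₀) h'), hm, Pi.single_eq_same, hsForm_self_fundamentalRep, gegenbauerSum_one] at h1
    have e2 : ∀ z : GaugeConfig 3 L (Matrix.specialUnitaryGroup (Fin 2) ℂ),
        (gegenbauerSum 1 1 (hsForm 2 (fundamentalRep (Fin 2) h) (fundamentalRep (Fin 2) (z e₀)) / 2)) ^ 2 =
        gegenbauerSum 1 1 (hsForm 2 (fundamentalRep (Fin 2) h) (fundamentalRep (Fin 2) (z e₀)) / 2) *
          gegenbauerSum 1 1 (hsForm 2 (fundamentalRep (Fin 2) h) (fundamentalRep (Fin 2) (z e₀)) / 2) := fun z => sq _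
    simp_rw [e2]
    rw [h1]; norm_num
  refine ⟨?_, ?_⟩
  · simp_rw [hκ, hmean, sub_zero]
    have e3 : ∀ x : GaugeConfig 3 L (Matrix.specialUnitaryGroup (Fin 2) ℂ),
        (Real.exp (-(3 / 2) * t) * gegenbauerSum 1 1 (hsForm 2 (fundamentalRep (Fin 2) h) (fundamentalRep (Fin 2) (x e₀)) / 2)) ^ 2 =
        Real.exp (-2 * (3 / 2) * t) *
          (gegenbauerSum 1 1 (hsForm 2 (fundamentalRep (Fin 2) h) (fundamentalRep (Fin 2) (x e₀)) / 2)) ^ 2 := by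
      intro x
      rw [mul_pow, ← Real.exp_nat_mul]; congr 1; congr 1; push_cast; ring
    simp_rw [e3]
    exact integral_const_mul _ _
  · simp_rw [hmean, sub_zero]
    exact hsq

/-! ## ★★ The Poincaré inequality with constant `3/2` for product Haar measure (generator form) -/

/-- ★★ **Generator-form Poincaré inequality with the explicit constant `3/2` for product Haar measure on `SU(2)^E`**: for every `C³`
function `f` of the real link coordinates, `F = f∘coords`, `m = ∫ F dμ₀` and the SZZ coordinate generator `𝓛₀f` at `β' = 0`
(drift = the Itô/Casimir correction only), `(3/2) ∫ (F − m)² dμ₀ ≤ −∫ (F − m) 𝓛₀f dμ₀` (`μ₀ = wilsonMeasure 0 = Haar^{⊗E}`).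
The explicit gap `integral_sq_transition_sub_le_exp_beta_zero` for THE kernels of `exists_transitionKernel L 0`, fed into g18's
converse `generatorPoincare_of_integral_sq_transition_sub_le_exp`.  The constant is optimal
(`integral_sq_transition_sub_eq_beta_zero_degree_one` + `generatorPoincare_implies_decay`). [cite: BakryGentilLedoux2014, Thm 4.2.5] -/
theorem haar_generatorPoincare (L : ℕ) [NeZero L]
    (f : (Edge 3 L × Fin 2 × Fin 2 × Bool → ℝ) → ℝ) (hf : ContDiff ℝ 3 f) :
    let coords : GaugeConfig 3 L (Matrix.specialUnitaryGroup (Fin 2) ℂ) → (Edge 3 L × Fin 2 × Fin 2 × Bool → ℝ) :=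
      fun V q => (fun z : ℂ => if q.2.2.2 then z.im else z.re)
        ((fundamentalRep (Fin 2) (V q.1) : Matrix (Fin 2) (Fin 2) ℂ) q.2.1 q.2.2.1)
    let gen : GaugeConfig 3 L (Matrix.specialUnitaryGroup (Fin 2) ℂ) → ℝ := fun V =>
      (∑ i : Edge 3 L × Fin 2 × Fin 2 × Bool, fderiv ℝ f (coords V) (Pi.single i 1) *
          (fun z : ℂ => if i.2.2.2 then z.im else z.re)
            ((latticeLangevinDynamics (fundamentalLatticeRep 2) 0).drift
              (matrixConfig (fundamentalRep (Fin 2)) V) i.1 i.2.1 i.2.2.1) +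
      1 / 2 * ∑ i : Edge 3 L × Fin 2 × Fin 2 × Bool, ∑ j : Edge 3 L × Fin 2 × Fin 2 × Bool,
        fderiv ℝ (fun z => fderiv ℝ f z (Pi.single i 1)) (coords V) (Pi.single j 1) *
          ∑ n : Edge 3 L × NoiseIdx 2,
            (if n.1 = i.1 then (fun z : ℂ => if i.2.2.2 then z.im else z.re)
              ((latticeLangevinDynamics (fundamentalLatticeRep 2) 0).noise
                (matrixConfig (fundamentalRep (Fin 2)) V) i.1 n.2 i.2.1 i.2.2.1) else 0) *
            (if n.1 = j.1 then (fun z : ℂ => if j.2.2.2 then z.im else z.re)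
              ((latticeLangevinDynamics (fundamentalLatticeRep 2) 0).noise
                (matrixConfig (fundamentalRep (Fin 2)) V) j.1 n.2 j.2.1 j.2.2.1) else 0))
    (3 / 2 : ℝ) * ∫ V, (f (coords V) - ∫ V', f (coords V') ∂(wilsonMeasure (d := 3) (L := L) (fundamentalRep (Fin 2)) 0)) ^ 2
        ∂(wilsonMeasure (d := 3) (L := L) (fundamentalRep (Fin 2)) 0) ≤
      -∫ V, (f (coords V) - ∫ V', f (coords V') ∂(wilsonMeasure (d := 3) (L := L) (fundamentalRep (Fin 2)) 0)) *
        gen V ∂(wilsonMeasure (d := 3) (L := L) (fundamentalRep (Fin 2)) 0) := by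
  obtain ⟨κ₀, hκ₀, -, hreal₀⟩ := exists_transitionKernel L 0
  haveI := hκ₀
  exact generatorPoincare_of_integral_sq_transition_sub_le_exp L 0 κ₀ hreal₀ (lam := 3 / 2)
    (fun G hG t => integral_sq_transition_sub_le_exp_beta_zero L κ₀ hreal₀ hG t) f hf

end Summit.QuantumFields.YangMills.Theorems.ColdStartUniversality

end
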